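import Literature.Computability.AlgebraicComplexity.StandardFamilies
import HarnessLib

/-!
# Bruhat-truncated determinants and permanents, cut-width truncated determinants

Topic `Literature/Computability/AlgebraicComplexity` (definition request `defn-bruhatDet`, wanted by
route `route-ValiantsHypothesis-PartialSorting`, item `stmt-ValiantsHypothesis-13592`). The route's
items inline the three polynomial sums below verbatim (over `k = ℂ`); this file names them so that
provers can share lemmas (`--supports`), and proves the elementary API.

For `w : Fin n → Fin n` (a permutation in the intended use, but any map is allowed, exactly as in
the route items) and a permutation `σ ∈ 𝔖ₙ`, write
`σ[i, j] := #{a ≤ i : j ≤ σ a}` (Björner–Brenti 2005, (2.3), 0-indexed). The **rank criterion**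
(Björner–Brenti 2005, Thm. 2.1.5) says that for `σ, w ∈ 𝔖ₙ`, `σ ≤ w` in Bruhat order iff
`σ[i, j] ≤ w[i, j]` for all `i, j`. The benchmark families posited by the route are

* `bruhatDet k n w = D_w := ∑_{σ : ∀ i j, σ[i,j] ≤ w[i,j]} sgn σ · ∏ₐ X_{a, σ a}` — the
  *Bruhat-truncated determinant* (the Leibniz expansion of `det (X_{ab})` truncated to the lower
  Bruhat interval `[e, w]`);
* `bruhatPer k n w` — its unsigned twin;
* `cutDet k n c := ∑_{σ : ∀ t, #{a ≤ t : t < σ a} ≤ c} sgn σ · ∏ₐ X_{a, σ a}` — the *cut-width-`c`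
  truncated determinant* (`#{a ≤ t : t < σ a}` is the number of values carried across the cut
  between positions `t` and `t + 1`).

## Main results (all proved)

* `card_rankSet_le_rev` — every permutation passes the rank test against the longest element
  `w₀ = Fin.rev`; hence `bruhatDet_rev : bruhatDet k n Fin.rev = detPoly (Fin n) k` and
  `bruhatPer_rev : bruhatPer k n Fin.rev = perPoly (Fin n) k`.
* `Equiv.Perm.eq_one_of_forall_apply_le`, `eq_one_of_rankSet_le_id` — only the identity passes the
  rank test against `e`; hence `bruhatDet_id`, `bruhatPer_id` (the diagonal monomial) and
  `cutDet_zero`.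
* `cutDet_of_le : n ≤ c → cutDet k n c = detPoly (Fin n) k`.
* `map_bruhatDet`, `map_bruhatPer`, `map_cutDet` (base change), `bruhatPer_eq_bruhatDet_of_charP_two`,
  `eval_bruhatDet` (value at a point = signed count), and the congruence
  `cutDet_eq_bruhatDet_of_iff` (the shape in which route item `CutWidthIdeal` identifies
  `cutDet k n (n / 4)` with `bruhatDet k n w⋆`).

## References

* A. Björner, F. Brenti, *Combinatorics of Coxeter Groups*, GTM 231, Springer 2005: (2.3) and
  Thm. 2.1.5 (rank criterion for Bruhat order on `S_n`; held copy, PDF p. 29). [BjornerBrenti2005]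
* P. Bürgisser, *Completeness and Reduction in Algebraic Complexity Theory*, Springer 2000, (2.1),
  (2.2) (generic determinant / permanent, `detPoly` / `perPoly` of `StandardFamilies.lean`).
  [Burgisser2000]

## Design notes

* The bodies are kept syntactically identical to the route items (inline `Finset.filter`/`card`
  rank sets, `Equiv.Perm.sign σ • ∏ a, X (a, σ a)`, `else 0`), so that
  `bruhatDet ℂ n (w n)` unfolds to the items' sums by `rfl`; no auxiliary predicate is interposed
  (a `bruhatLE` order on `Fin n → Fin n` is a separate request, topic `Combinatorics/Coxeter`).
* Row convention `∏ a, X (a, σ a)` (rows indexed by positions), whereas Mathlib's `Matrix.det` /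
  `Matrix.permanent` expand as `∏ i, M (σ i) i`; the bridge is `Matrix.det_transpose` /
  `Matrix.permanent_transpose`.
-/

noncomputable section

open MvPolynomial Finset

namespace Literature.Computability.AlgebraicComplexity

universe u

variable (k : Type u)

section Defs

/-- The **Bruhat-truncated determinant** `D_w = ∑_{σ ≤ w} sgn σ · ∏ₐ X_{a, σ a}` in the `n²`
variables `X_{ab}`, where `σ ≤ w` is decided by the rank criterion of Björner–Brenti, Thm. 2.1.5
with (2.3): `#{a ≤ i : j ≤ σ a} ≤ #{a ≤ i : j ≤ w a}` for all `i, j` (for a non-bijective `w` the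
truncation set is still a lower set of the Bruhat order). Benchmark family posited by route
`PartialSorting` of `Summits/ValiantsHypothesis` (body verbatim the route items' inlined sum); the
polynomial itself is not taken from a published source.
[cite: BjornerBrenti2005, Thm. 2.1.5 with (2.3) (rank criterion for Bruhat order on S_n)] -/
def bruhatDet [CommRing k] (n : ℕ) (w : Fin n → Fin n) : MvPolynomial (Fin n × Fin n) k :=
  ∑ σ : Equiv.Perm (Fin n),
    if (∀ i j : Fin n, (Finset.univ.filter (fun a : Fin n => a ≤ i ∧ j ≤ σ a)).card ≤
        (Finset.univ.filter (fun a : Fin n => a ≤ i ∧ j ≤ w a)).card)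
    then Equiv.Perm.sign σ • ∏ a : Fin n, MvPolynomial.X (a, σ a)
    else 0

/-- The **Bruhat-truncated permanent** `∑_{σ ≤ w} ∏ₐ X_{a, σ a}`, the unsigned twin of
`bruhatDet` (same rank-criterion truncation, Björner–Brenti Thm. 2.1.5 with (2.3)). Posited by route
`PartialSorting` of `Summits/ValiantsHypothesis`; not taken from a published source.
[cite: BjornerBrenti2005, Thm. 2.1.5 with (2.3) (rank criterion for Bruhat order on S_n)] -/
def bruhatPer [CommSemiring k] (n : ℕ) (w : Fin n → Fin n) : MvPolynomial (Fin n × Fin n) k :=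
  ∑ σ : Equiv.Perm (Fin n),
    if (∀ i j : Fin n, (Finset.univ.filter (fun a : Fin n => a ≤ i ∧ j ≤ σ a)).card ≤
        (Finset.univ.filter (fun a : Fin n => a ≤ i ∧ j ≤ w a)).card)
    then ∏ a : Fin n, MvPolynomial.X (a, σ a)
    else 0

/-- The **cut-width-`c` truncated determinant**
`CutDet_{n,c} = ∑_{σ : ∀ t, #{a ≤ t : t < σ a} ≤ c} sgn σ · ∏ₐ X_{a, σ a}`: the Leibniz expansion
truncated to the permutations carrying at most `c` values across every cut `t | t+1`
(`#{a ≤ t : t < σ a}` is the rank-set count `σ[t, t+1]` of Björner–Brenti (2.3), 0-indexed).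
Posited by route `PartialSorting` of `Summits/ValiantsHypothesis` (items `CutDetNotVP`,
`BoundedWidthInVP`, `CutWidthIdeal` inline this sum); not taken from a published source.
[cite: BjornerBrenti2005, (2.3) (rank sets σ[i,j])] -/
def cutDet [CommRing k] (n c : ℕ) : MvPolynomial (Fin n × Fin n) k :=
  ∑ σ : Equiv.Perm (Fin n),
    if (∀ t : Fin n, (Finset.univ.filter (fun a : Fin n => a ≤ t ∧ t < σ a)).card ≤ c)
    then Equiv.Perm.sign σ • ∏ a : Fin n, MvPolynomial.X (a, σ a)
    else 0

end Defs

/-! ### The rank test against `w₀ = Fin.rev` and against `e = id` -/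

section Rank

variable {n : ℕ}

/-- Every permutation lies below the longest element in the rank-criterion form:
`#{a ≤ i : j ≤ σ a} ≤ #{a ≤ i : j ≤ rev a}` (`= min (i, rev j) + 1`). If `i ≤ rev j` the right
set is all of `{a ≤ i}`; otherwise it is `{a : j ≤ rev a}`, which has as many elements as
`{a : j ≤ σ a}` (bijection `a ↦ rev (σ a)`). [cite: BjornerBrenti2005, Thm. 2.1.5 with (2.4)] -/
theorem card_rankSet_le_rev (σ : Equiv.Perm (Fin n)) (i j : Fin n) :
    (univ.filter (fun a : Fin n => a ≤ i ∧ j ≤ σ a)).card ≤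
      (univ.filter (fun a : Fin n => a ≤ i ∧ j ≤ Fin.rev a)).card := by
  by_cases h : i ≤ Fin.rev j
  · refine card_le_card fun a ha => ?_
    simp only [mem_filter, mem_univ, true_and] at ha ⊢
    exact ⟨ha.1, Fin.le_rev_iff.1 (ha.1.trans h)⟩
  · rw [not_le] at h
    calc (univ.filter (fun a : Fin n => a ≤ i ∧ j ≤ σ a)).card
        ≤ (univ.filter (fun a : Fin n => j ≤ σ a)).card :=
          card_le_card fun a ha => by
            simp only [mem_filter, mem_univ, true_and] at ha ⊢
            exact ha.2
      _ = (univ.filter (fun a : Fin n => j ≤ Fin.rev a)).card := by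
          refine card_equiv (σ.trans Fin.revPerm) fun a => ?_
          simp
      _ ≤ (univ.filter (fun a : Fin n => a ≤ i ∧ j ≤ Fin.rev a)).card :=
          card_le_card fun a ha => by
            simp only [mem_filter, mem_univ, true_and] at ha ⊢
            exact ⟨((Fin.le_rev_iff.2 ha).trans h.le), ha⟩

/-- A permutation of `Fin n` with `σ a ≤ a` for every `a` is the identity (compare `∑ a, σ a`
with `∑ a, a`). [folklore] -/
theorem _root_.Equiv.Perm.eq_one_of_forall_apply_le (σ : Equiv.Perm (Fin n))
    (h : ∀ a, σ a ≤ a) : σ = 1 := by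
  have hsum : ∑ a : Fin n, ((σ a : Fin n) : ℕ) = ∑ a : Fin n, (a : ℕ) :=
    Equiv.sum_comp σ (fun a : Fin n => (a : ℕ))
  have hle : ∀ a ∈ (univ : Finset (Fin n)), ((σ a : Fin n) : ℕ) ≤ (a : ℕ) := fun a _ => h a
  have heq := (Finset.sum_eq_sum_iff_of_le hle).1 hsum
  ext a
  exact heq a (mem_univ a)

/-- Only the identity passes the rank test against `e`: if `#{a ≤ i : j ≤ σ a} ≤ #{a ≤ i : j ≤ a}`
for all `i, j`, then `σ = 1` (at `i = a`, `j = σ a > a` the left set contains `a` and the right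
set is empty). [cite: BjornerBrenti2005, Thm. 2.1.5] -/
theorem eq_one_of_rankSet_le_id (σ : Equiv.Perm (Fin n))
    (h : ∀ i j : Fin n, (univ.filter (fun a : Fin n => a ≤ i ∧ j ≤ σ a)).card ≤
      (univ.filter (fun a : Fin n => a ≤ i ∧ j ≤ a)).card) : σ = 1 := by
  refine σ.eq_one_of_forall_apply_le fun a => ?_
  by_contra hlt
  rw [not_le] at hlt
  have h1 : 1 ≤ (univ.filter (fun b : Fin n => b ≤ a ∧ σ a ≤ σ b)).card := by
    rw [Nat.one_le_iff_ne_zero, Ne, card_eq_zero, filter_eq_empty_iff]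
    intro hemp
    exact hemp (mem_univ a) ⟨le_rfl, le_rfl⟩
  have h0 : (univ.filter (fun b : Fin n => b ≤ a ∧ σ a ≤ b)).card = 0 := by
    rw [card_eq_zero, filter_eq_empty_iff]
    rintro b - ⟨hba, hab⟩
    exact (lt_irrefl _) ((hab.trans hba).trans_lt hlt)
  have := (h1.trans (h a (σ a)))
  rw [h0] at this
  exact Nat.not_succ_le_zero 0 this

end Rank

/-! ### Special values -/

section Values

variable {k} {n : ℕ}

/-- `D_{w₀} = det`: against the longest element `w₀ = rev` the truncation is empty, and the full
signed sum is the determinant of the transposed generic matrix, i.e. `detPoly`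
(`Matrix.det_transpose`; Bürgisser 2000, (2.1)). [cite: Burgisser2000, (2.1)] -/
theorem bruhatDet_rev [CommRing k] : bruhatDet k n Fin.rev = detPoly (Fin n) k := by
  unfold bruhatDet
  rw [detPoly, ← Matrix.det_transpose, Matrix.det_apply]
  refine sum_congr rfl fun σ _ => ?_
  rw [if_pos (fun i j => card_rankSet_le_rev σ i j)]
  simp [Matrix.transpose_apply, Matrix.mvPolynomialX]

/-- The unsigned twin: against `w₀ = rev` the Bruhat-truncated permanent is the generic permanent
`perPoly` (`Matrix.permanent_transpose`; Bürgisser 2000, (2.2)). [cite: Burgisser2000, (2.2)] -/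
theorem bruhatPer_rev [CommSemiring k] : bruhatPer k n Fin.rev = perPoly (Fin n) k := by
  unfold bruhatPer
  rw [perPoly, ← Matrix.permanent_transpose, Matrix.permanent]
  refine sum_congr rfl fun σ _ => ?_
  rw [if_pos (fun i j => card_rankSet_le_rev σ i j)]
  simp [Matrix.transpose_apply, Matrix.mvPolynomialX]

/-- `D_e = ∏ₐ X_{a,a}`: against the identity only `σ = 1` survives the rank test
(`eq_one_of_rankSet_le_id`). [cite: BjornerBrenti2005, Thm. 2.1.5] -/
theorem bruhatDet_id [CommRing k] : bruhatDet k n id = ∏ a : Fin n, X (a, a) := by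
  unfold bruhatDet
  rw [sum_eq_single (1 : Equiv.Perm (Fin n))]
  · simp
  · intro σ _ hσ
    rw [if_neg]
    exact fun h => hσ (eq_one_of_rankSet_le_id σ h)
  · exact fun h => (h (mem_univ _)).elim

/-- Unsigned twin of `bruhatDet_id`. [cite: BjornerBrenti2005, Thm. 2.1.5] -/
theorem bruhatPer_id [CommSemiring k] : bruhatPer k n id = ∏ a : Fin n, X (a, a) := by
  unfold bruhatPer
  rw [sum_eq_single (1 : Equiv.Perm (Fin n))]
  · simp
  · intro σ _ hσ
    rw [if_neg]
    exact fun h => hσ (eq_one_of_rankSet_le_id σ h)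
  · exact fun h => (h (mem_univ _)).elim

/-- Width `≥ n` is no constraint: `cutDet k n c = detPoly (Fin n) k` for `n ≤ c` (each cut set is
a subset of `Fin n`). [cite: Burgisser2000, (2.1)] -/
theorem cutDet_of_le [CommRing k] {c : ℕ} (hc : n ≤ c) : cutDet k n c = detPoly (Fin n) k := by
  unfold cutDet
  rw [detPoly, ← Matrix.det_transpose, Matrix.det_apply]
  refine sum_congr rfl fun σ _ => ?_
  rw [if_pos (fun t => ((card_le_univ _).trans_eq (Fintype.card_fin n)).trans hc)]
  simp [Matrix.transpose_apply, Matrix.mvPolynomialX]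

/-- Width `0` forces `σ a ≤ a` for all `a`, hence `σ = 1`: `cutDet k n 0 = ∏ₐ X_{a,a}`.
[folklore] -/
theorem cutDet_zero [CommRing k] : cutDet k n 0 = ∏ a : Fin n, X (a, a) := by
  unfold cutDet
  rw [sum_eq_single (1 : Equiv.Perm (Fin n))]
  · rw [if_pos]
    · simp
    · intro t
      rw [Nat.le_zero, card_eq_zero, filter_eq_empty_iff]
      rintro b - ⟨hbt, htb⟩
      exact (lt_irrefl _) (htb.trans_le (by simpa using hbt))
  · intro σ _ hσ
    rw [if_neg]
    intro h
    refine hσ (σ.eq_one_of_forall_apply_le fun a => ?_)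
    by_contra hlt
    rw [not_le] at hlt
    have h0 := h a
    rw [Nat.le_zero, card_eq_zero, filter_eq_empty_iff] at h0
    exact h0 (mem_univ a) ⟨le_rfl, hlt⟩
  · exact fun h => (h (mem_univ _)).elim

end Values

/-! ### Base change, characteristic two, evaluation, congruence -/

section API

variable {k} {n : ℕ}

/-- Base change: `bruhatDet` is defined over `ℤ` (coefficients `0, ±1`), so it is preserved by
`MvPolynomial.map f` for every ring hom `f`. [folklore] -/
theorem map_bruhatDet [CommRing k] {k' : Type*} [CommRing k'] (f : k →+* k') (w : Fin n → Fin n) :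
    map f (bruhatDet k n w) = bruhatDet k' n w := by
  unfold bruhatDet
  rw [map_sum]
  refine sum_congr rfl fun σ _ => ?_
  split_ifs
  · simp [Units.smul_def, map_prod]
  · simp

/-- Base change for `bruhatPer` (coefficients `0, 1`). [folklore] -/
theorem map_bruhatPer [CommSemiring k] {k' : Type*} [CommSemiring k'] (f : k →+* k')
    (w : Fin n → Fin n) : map f (bruhatPer k n w) = bruhatPer k' n w := by
  unfold bruhatPer
  rw [map_sum]
  refine sum_congr rfl fun σ _ => ?_
  split_ifs
  · simp [map_prod]
  · simp

/-- Base change for `cutDet` (coefficients `0, ±1`). [folklore] -/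
theorem map_cutDet [CommRing k] {k' : Type*} [CommRing k'] (f : k →+* k') (c : ℕ) :
    map f (cutDet k n c) = cutDet k' n c := by
  unfold cutDet
  rw [map_sum]
  refine sum_congr rfl fun σ _ => ?_
  split_ifs
  · simp [Units.smul_def, map_prod]
  · simp

/-- In characteristic `2` the Bruhat-truncated permanent and determinant coincide (all signs are
`1`; same truncation set), cf. `perPoly_eq_detPoly_of_charP_two`. [folklore] -/
theorem bruhatPer_eq_bruhatDet_of_charP_two [CommRing k] [CharP k 2] (w : Fin n → Fin n) :
    bruhatPer k n w = bruhatDet k n w := by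
  unfold bruhatPer bruhatDet
  refine sum_congr rfl fun σ _ => ?_
  split_ifs
  · rcases Int.units_eq_one_or (Equiv.Perm.sign σ) with h | h
    · simp [h]
    · rw [h, Units.neg_smul, one_smul, CharTwo.neg_eq]
  · rfl

/-- Value at a point `s` (e.g. a `0/1` matrix): the signed count
`∑_{σ ≤ w} sgn σ · ∏ₐ s (a, σ a)` of the permutations inside the truncation set, weighted by `s`.
[folklore] -/
theorem eval_bruhatDet [CommRing k] (s : Fin n × Fin n → k) (w : Fin n → Fin n) :
    eval s (bruhatDet k n w) = ∑ σ : Equiv.Perm (Fin n),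
      if (∀ i j : Fin n, (Finset.univ.filter (fun a : Fin n => a ≤ i ∧ j ≤ σ a)).card ≤
          (Finset.univ.filter (fun a : Fin n => a ≤ i ∧ j ≤ w a)).card)
      then Equiv.Perm.sign σ • ∏ a : Fin n, s (a, σ a) else 0 := by
  unfold bruhatDet
  rw [map_sum]
  refine sum_congr rfl fun σ _ => ?_
  split_ifs
  · simp [Units.smul_def, map_prod]
  · simp

/-- Value of `bruhatPer` at a point: the count `∑_{σ ≤ w} ∏ₐ s (a, σ a)`. [folklore] -/
theorem eval_bruhatPer [CommSemiring k] (s : Fin n × Fin n → k) (w : Fin n → Fin n) :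
    eval s (bruhatPer k n w) = ∑ σ : Equiv.Perm (Fin n),
      if (∀ i j : Fin n, (Finset.univ.filter (fun a : Fin n => a ≤ i ∧ j ≤ σ a)).card ≤
          (Finset.univ.filter (fun a : Fin n => a ≤ i ∧ j ≤ w a)).card)
      then ∏ a : Fin n, s (a, σ a) else 0 := by
  unfold bruhatPer
  rw [map_sum]
  refine sum_congr rfl fun σ _ => ?_
  split_ifs
  · simp [map_prod]
  · simp

/-- Congruence: if the width-`c` cut condition and the rank test against `w` select the same
permutations, then `cutDet k n c = bruhatDet k n w`. This is the shape in which route item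
`CutWidthIdeal` (the Bruhat ideal of `w⋆` is the set of permutations of cut-width `≤ ⌊n/4⌋`) turns
into the polynomial identity `cutDet k n (n / 4) = bruhatDet k n w⋆`. [folklore] -/
theorem cutDet_eq_bruhatDet_of_iff [CommRing k] {c : ℕ} {w : Fin n → Fin n}
    (h : ∀ σ : Equiv.Perm (Fin n),
      (∀ i j : Fin n, (Finset.univ.filter (fun a : Fin n => a ≤ i ∧ j ≤ σ a)).card ≤
          (Finset.univ.filter (fun a : Fin n => a ≤ i ∧ j ≤ w a)).card) ↔
        ∀ t : Fin n, (Finset.univ.filter (fun a : Fin n => a ≤ t ∧ t < σ a)).card ≤ c) :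
    cutDet k n c = bruhatDet k n w := by
  unfold cutDet bruhatDet
  refine sum_congr rfl fun σ _ => ?_
  exact if_congr (h σ).symm rfl rfl

/-- Congruence between two Bruhat truncations selecting the same permutations (e.g. two maps `w`,
`w'` with the same rank sets). [folklore] -/
theorem bruhatDet_congr [CommRing k] {w w' : Fin n → Fin n}
    (h : ∀ σ : Equiv.Perm (Fin n),
      (∀ i j : Fin n, (Finset.univ.filter (fun a : Fin n => a ≤ i ∧ j ≤ σ a)).card ≤
          (Finset.univ.filter (fun a : Fin n => a ≤ i ∧ j ≤ w a)).card) ↔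
        ∀ i j : Fin n, (Finset.univ.filter (fun a : Fin n => a ≤ i ∧ j ≤ σ a)).card ≤
          (Finset.univ.filter (fun a : Fin n => a ≤ i ∧ j ≤ w' a)).card) :
    bruhatDet k n w = bruhatDet k n w' := by
  unfold bruhatDet
  refine sum_congr rfl fun σ _ => ?_
  exact if_congr (h σ) rfl rfl

end API

end Literature.Computability.AlgebraicComplexity

end
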